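import Literature.AlgebraicGeometry.Modules.BoundedCoherentVBModelsOfRepresentative
import Literature.AlgebraicGeometry.Modules.QcRepresentativeOfSeparated
import Literature.AlgebraicGeometry.Motives.VarietiesProperProofs
import HarnessLib

/-!
# Bounded vector-bundle models of bounded-coherent objects of `D⁺(Mod 𝒪_X)` on projective regular schemes and on
# smooth projective varieties over a field (Thomason–Trobaugh 2.3.1 (d) ∧ Auslander–Buchsbaum–Serre ∧ SGA 6 II 3.5)

Layer `Literature/AlgebraicGeometry/Modules`. For a scheme `X` PROJECTIVE over a field `k`
(`Motives/Varieties.IsProjectiveOver`: a closed `k`-immersion into some `ℙᴺ_k`) whose local rings are regular of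
bounded Krull dimension — in particular for every SMOOTH PROJECTIVE VARIETY (`Motives/Varieties.IsSmoothProjective n X`,
the objects the summit's `HodgeConjectureFor` quantifies over), over ANY field and in any universe — every object `E`
of the bounded-below derived category `D⁺(Mod 𝒪_X)` whose cohomology sheaves are bounded (`E.IsGE a`, `E.IsLE b`) and
coherent (`Morphisms/DevissageClass.Coh`) is isomorphic to the class `Q⁺⟨K, m⟩` of a BOUNDED complex `K` of finite
locally free `𝒪_X`-modules (`KTheory/EulerCharacteristic.IsBoundedVBComplex`):

* §1 `isRegular_of_smooth`, `exists_specializes_isClosed`, `ringKrullDim_stalk_le_of_smoothOfRelativeDimension` — a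
  `k`-scheme smooth of relative dimension `n` is regular (Stacks 056S) with `dim 𝒪_{X,x} ≤ n` at EVERY point
  (`= n` at the closed points, Görtz–Wedhorn 6.28; every point specialises to a closed point since `X` is Jacobson);
* §2 `IsProjectiveOver.exists_qcRepresentative` — Stage I of the `D⁺_qc` comparison on a projective `k`-scheme
  (projective ⇒ proper ⇒ separated and quasi-compact; `Modules/QcRepresentativeOfSeparated.exists_qcRepresentative_of_compactSpace`,
  Görtz–Wedhorn II Lemma 22.36 ∕ Hartshorne RD II 7.19); `IsProjectiveOver.exists_isBoundedVBComplex_of_boundedCoh_of_isRegular`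
  — the vector-bundle model on a projective regular `k`-scheme of bounded dimension (Stage I + Serre's lifting
  `Modules/QuasicoherentEpiDominatedByVectorBundle.IsProjectiveOver.exists_isFiniteLocallyFree_epi_comp` + the K-phase
  `Modules/BoundedCoherentVBModelsOfRepresentative.exists_vbModel_of_qcRepresentative_of_isLE`);
  `IsProjectiveOver.nonempty_strictlyPerfectResolution_of_coh_of_isRegular` — Hartshorne III Ex. 6.9 (a) (finite locally
  free resolutions of coherent sheaves) on such a scheme;
* §3 **`IsSmoothProjective.exists_isBoundedVBComplex_of_boundedCoh`** and
  **`IsSmoothProjective.nonempty_strictlyPerfectResolution_of_coh`** — the same on every smooth projective variety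
  over a field, unconditionally (§1 feeds §2).

This is the `TODO(general form)` direction of `Modules/BoundedCoherentVBModels.lean` written for smooth projective
varieties; the abelian-variety statement displayed there (`ThomasonTrobaugh_vbModel_of_boundedCoh`) is neither restated
nor specialised here. Everything is PROVED from tree theorems; 0 named facts, no definitions, no instances
(separatedness, quasi-compactness and local noetherianity of a projective `k`-scheme are derived inside the proofs
from `IsProjectiveOver.isProper`).

## References

* R. W. Thomason, T. Trobaugh, *Higher algebraic K-theory of schemes and of derived categories*, The Grothendieck
  Festschrift III (1990), Prop. 2.3.1 (d), Appendix B (B.16). [ThomasonTrobaugh1990]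
* P. Berthelot, A. Grothendieck, L. Illusie, *SGA 6*, Exp. II, Cor. 2.2.2.1, Prop. 3.5. [SGA6]
* U. Görtz, T. Wedhorn, *Algebraic Geometry I* (2nd ed. 2020), Lemma 6.26, Thm. 6.28; *Algebraic Geometry II* (2023),
  Lemma 22.36, Thm. 22.35. [GortzWedhorn2020] [GortzWedhorn2023]
* R. Hartshorne, *Algebraic Geometry*, GTM 52 (1977), II Thm. 4.9, II Cor. 5.18, III Ex. 6.8, 6.9 (a). [Hartshorne1977]
* W. Fulton, *Intersection Theory* (2nd ed. 1998), App. B.8.3. [Fulton1998]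
* The Stacks Project, Tags 056S (smooth over a field ⇒ regular), 09T4, 0FDC. [StacksProject]
* D. Huybrechts, *Fourier–Mukai transforms in algebraic geometry* (2006), Prop. 3.26. [HuybrechtsFM2006]
-/

noncomputable section

universe w u

open CategoryTheory CategoryTheory.Limits AlgebraicGeometry TopologicalSpace

namespace Literature.AlgebraicGeometry.Modules

open Literature.AlgebraicGeometry.Morphisms Literature.AlgebraicGeometry.Motives
  Literature.AlgebraicGeometry.KTheory Literature.AlgebraicGeometry.Resolution

variable {k : Type u} [Field k]

/-! ## §1 Schemes smooth over a field: regularity and the dimension of the local rings -/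

section Smooth

variable {X : Scheme.{u}} (f : X ⟶ Spec (CommRingCat.of k))

/-- **A scheme smooth over a field is regular** (every local ring `𝒪_{X,x}` is a regular local ring; the tree's
`Resolution/SmoothStalksRegular.isRegularLocalRing_stalk_of_smooth_of_field` at every point).
[cite: StacksProject, Tag 056S] -/
theorem isRegular_of_smooth [Smooth f] : Scheme.IsRegular X := fun x =>
  isRegularLocalRing_stalk_of_smooth_of_field f x

/-- **Every point of a scheme locally of finite type over a field specialises to a closed point**: `X` is a
Jacobson space (Mathlib `LocallyOfFiniteType.jacobsonSpace`), so the closed subset `closure {x}` contains a closed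
point of `X`. [cite: GortzWedhorn2020, Prop. 3.35] [cite: StacksProject, Tag 01TB] -/
theorem exists_specializes_isClosed [LocallyOfFiniteType f] (x : X) :
    ∃ c : X, x ⤳ c ∧ IsClosed ({c} : Set X) := by
  haveI : JacobsonSpace X := LocallyOfFiniteType.jacobsonSpace f
  obtain ⟨c, hc, hccl⟩ := nonempty_inter_closedPoints (Z := closure ({x} : Set X)) ⟨x, subset_closure rfl⟩
    isClosed_closure.isLocallyClosed
  exact ⟨c, specializes_iff_mem_closure.mpr hc, hccl⟩

/-- **On a scheme smooth of relative dimension `n` over a field, `dim 𝒪_{X,x} ≤ n` at every point**: the dimension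
is `n` at the closed points (`Dimension/SmoothRelativeDimensionOfClosedPoints`, Görtz–Wedhorn 6.28 (vi)) and does not
increase under generisation (`ringKrullDim_stalk_le_of_specializes`), every point specialising to a closed point
(`exists_specializes_isClosed`). [cite: GortzWedhorn2020, Lemma 6.26 and Thm. 6.28 (vi)] [cite: StacksProject, Tag 02IZ] -/
theorem ringKrullDim_stalk_le_of_smoothOfRelativeDimension (n : ℕ) [SmoothOfRelativeDimension n f] (x : X) :
    ringKrullDim (X.presheaf.stalk x) ≤ n := by
  haveI : Smooth f := SmoothOfRelativeDimension.smooth n f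
  obtain ⟨c, h, hccl⟩ := exists_specializes_isClosed f x
  calc ringKrullDim (X.presheaf.stalk x) ≤ ringKrullDim (X.presheaf.stalk c) :=
        ringKrullDim_stalk_le_of_specializes h
    _ = n := Dimension.ringKrullDim_stalk_eq_of_smoothOfRelativeDimension_of_isClosed (f := f) n hccl
    _ ≤ n := le_rfl

end Smooth

/-! ## §2 Projective `k`-schemes: Stage I and the vector-bundle model on a projective regular scheme -/

section Projective

variable {X : SchemeOver k}

/-- **Stage I of the `D⁺_qc` comparison on a projective `k`-scheme**: every `E ∈ D⁺(Mod 𝒪_X)` with `E.IsGE a` whose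
cohomology sheaves are affine-localizing (quasi-coherent) is the class `Q⁺⟨M, a, _⟩` of a bounded-below complex `M` of
QUASI-COHERENT modules. A projective `k`-scheme is proper over `k` (`Motives/VarietiesProperProofs.IsProjectiveOver.isProper`,
Hartshorne II Thm. 4.9), hence separated and quasi-compact, and `Modules/QcRepresentativeOfSeparated.exists_qcRepresentative_of_compactSpace`
applies. [cite: GortzWedhorn2023, Lemma 22.36 and Thm. 22.35 (pp. 349–350)] [cite: HartshorneRD1966, II Cor. 7.19 (p. 133)]
[cite: Hartshorne1977, II Thm. 4.9 (p. 103)] -/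
theorem IsProjectiveOver.exists_qcRepresentative (hX : IsProjectiveOver X) [HasDerivedCategory.{w} X.left.Modules]
    (E : DerivedCategory.Plus X.left.Modules) (a : ℤ) [E.IsGE a]
    (hqc : ∀ i : ℤ, IsAffineLocalizing ((DerivedCategory.Plus.homologyFunctor _ i).obj E)) :
    ∃ (M : CochainComplex X.left.Modules ℤ) (hn : M.IsStrictlyGE a),
      (∀ i, (M.X i).IsQuasicoherent) ∧ (∀ i, IsAffineLocalizing (M.X i)) ∧
      Nonempty (DerivedCategory.Plus.Q.obj ⟨M, a, hn⟩ ≅ E) := by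
  haveI : IsProper X.hom := hX.isProper
  haveI : X.left.IsSeparated := by
    constructor
    rw [← terminal.comp_from X.hom]
    infer_instance
  haveI : CompactSpace X.left := QuasiCompact.compactSpace_of_compactSpace X.hom
  exact exists_qcRepresentative_of_compactSpace E a hqc

/-- **Bounded vector-bundle models on a projective regular `k`-scheme of bounded dimension** (Thomason–Trobaugh
2.3.1 (d) ∧ regularity): let `X` be projective over a field `k` with regular local rings of Krull dimension `≤ d`.
Then every `E ∈ D⁺(Mod 𝒪_X)` with `E.IsGE a`, `E.IsLE b` and coherent cohomology sheaves is isomorphic to `Q⁺⟨K, m, _⟩`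
for a BOUNDED complex `K` of finite locally free `𝒪_X`-modules. Proof: Stage I (`IsProjectiveOver.exists_qcRepresentative`,
coherent ⇒ affine-localizing by `Coh.loc`), Serre's lifting property of the projective `X`
(`IsProjectiveOver.exists_isFiniteLocallyFree_epi_comp`, Hartshorne II Cor. 5.18) and the K-phase
`exists_vbModel_of_qcRepresentative_of_isLE` (bounded-above locally free resolution terminated by the syzygy theorem on
the regular `X`). [cite: ThomasonTrobaugh1990, Prop. 2.3.1 (d) and Appendix B] [cite: SGA6, Exp. II Cor. 2.2.2.1 and Prop. 3.5]
[cite: Hartshorne1977, II Cor. 5.18 (p. 121) and III Ex. 6.9 (a) (p. 238)] [cite: HuybrechtsFM2006, Prop. 3.26] -/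
theorem IsProjectiveOver.exists_isBoundedVBComplex_of_boundedCoh_of_isRegular (hX : IsProjectiveOver X)
    (hreg : Scheme.IsRegular X.left) {d : ℕ} (hdim : ∀ x : X.left, ringKrullDim (X.left.presheaf.stalk x) ≤ d)
    [HasDerivedCategory.{w} X.left.Modules] (E : DerivedCategory.Plus X.left.Modules) (a b : ℤ)
    (hE : E.IsGE a) (hb : E.IsLE b) (hcoh : ∀ i : ℤ, Coh ((DerivedCategory.Plus.homologyFunctor _ i).obj E)) :
    ∃ (K : CochainComplex X.left.Modules ℤ) (_ : IsBoundedVBComplex K) (m : ℤ) (hm : K.IsStrictlyGE m),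
      Nonempty (DerivedCategory.Plus.Q.obj ⟨K, m, hm⟩ ≅ E) := by
  haveI := hE
  haveI : IsProper X.hom := hX.isProper
  haveI : IsLocallyNoetherian X.left := LocallyOfFiniteType.isLocallyNoetherian X.hom
  obtain ⟨M, hn, -, hM, ⟨eM⟩⟩ := IsProjectiveOver.exists_qcRepresentative hX E a (fun i => (hcoh i).loc)
  exact exists_vbModel_of_qcRepresentative_of_isLE hreg hdim
    (fun g _ hF hG => IsProjectiveOver.exists_isFiniteLocallyFree_epi_comp hX g hF hG) E a b hE hb hcoh M hn hM eM

/-- **Hartshorne III Ex. 6.9 (a) on a projective regular `k`-scheme of bounded dimension**: every coherent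
`𝒪_X`-module has a finite resolution by finite locally free modules (a `StrictlyPerfectResolution`): the resolution
property of the projective `X` (`IsProjectiveOver.exists_isFiniteLocallyFree_epi_of_coh`, Hartshorne II Cor. 5.18)
and `nonempty_strictlyPerfectResolution_of_coh_of_isRegular`. [cite: Hartshorne1977, III Ex. 6.9 (a) (p. 238) and II Cor. 5.18 (p. 121)]
[cite: Fulton1998, App. B.8.3] -/
theorem IsProjectiveOver.nonempty_strictlyPerfectResolution_of_coh_of_isRegular (hX : IsProjectiveOver X)
    (hreg : Scheme.IsRegular X.left) {d : ℕ} (hdim : ∀ x : X.left, ringKrullDim (X.left.presheaf.stalk x) ≤ d)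
    {F : X.left.Modules} (hF : Coh F) : Nonempty (StrictlyPerfectResolution F) := by
  haveI : IsProper X.hom := hX.isProper
  haveI : IsLocallyNoetherian X.left := LocallyOfFiniteType.isLocallyNoetherian X.hom
  -- (fully qualified: inside this declaration the short name would resolve to the declaration itself)
  exact Literature.AlgebraicGeometry.Modules.nonempty_strictlyPerfectResolution_of_coh_of_isRegular
    (fun G hG => IsProjectiveOver.exists_isFiniteLocallyFree_epi_of_coh hX hG) hreg hdim hF

end Projective

/-! ## §3 Smooth projective varieties over a field -/

section SmoothProjective

variable {n : ℕ} {X : SchemeOver k}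

/-- A smooth projective variety over a field is a regular scheme (§1 `isRegular_of_smooth`). The same statement is
proved Summit-side as `Summit.HodgeConjecture.HodgeConjecture.Theorems.isRegular_of_isSmoothProjective`
(`Theorems/BoundaryReadoutPullbackAlgebraicDeformationDatum`), which Literature files cannot import; it is restated here
for Literature consumers. [cite: StacksProject, Tag 056S] -/
theorem IsSmoothProjective.isRegular (hX : IsSmoothProjective n X) : Scheme.IsRegular X.left := by
  haveI := hX.smoothOfRelativeDimension
  haveI : Smooth X.hom := SmoothOfRelativeDimension.smooth n X.hom
  exact isRegular_of_smooth X.hom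

/-- The local rings of a smooth projective variety of dimension `n` have Krull dimension `≤ n` (§1
`ringKrullDim_stalk_le_of_smoothOfRelativeDimension`). [cite: GortzWedhorn2020, Lemma 6.26 and Thm. 6.28 (vi)] -/
theorem IsSmoothProjective.ringKrullDim_stalk_le (hX : IsSmoothProjective n X) (x : X.left) :
    ringKrullDim (X.left.presheaf.stalk x) ≤ n := by
  haveI := hX.smoothOfRelativeDimension
  exact ringKrullDim_stalk_le_of_smoothOfRelativeDimension X.hom n x

/-- **Bounded-coherent objects of `D⁺(Mod 𝒪_X)` on a smooth projective variety over a field are classes of bounded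
vector-bundle complexes** (Thomason–Trobaugh 2.3.1 (d) ∧ Auslander–Buchsbaum–Serre ∧ SGA 6 II 2.2.2.1 ∕ 3.5): for
`X` smooth projective of dimension `n` over a field `k`, every `E ∈ D⁺(Mod 𝒪_X)` with `E.IsGE a`, `E.IsLE b` and
coherent cohomology sheaves is isomorphic to `Q⁺⟨K, m, _⟩` for a bounded complex `K` of finite locally free
`𝒪_X`-modules — §2 on the projective `X`, regular of dimension `≤ n` by §1∕§3.
[cite: ThomasonTrobaugh1990, Prop. 2.3.1 (d) and Appendix B] [cite: SGA6, Exp. II Cor. 2.2.2.1 and Prop. 3.5]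
[cite: HuybrechtsFM2006, Prop. 3.26] [cite: GortzWedhorn2023, Lemma 22.36] -/
theorem IsSmoothProjective.exists_isBoundedVBComplex_of_boundedCoh (hX : IsSmoothProjective n X)
    [HasDerivedCategory.{w} X.left.Modules] (E : DerivedCategory.Plus X.left.Modules) (a b : ℤ)
    (hE : E.IsGE a) (hb : E.IsLE b) (hcoh : ∀ i : ℤ, Coh ((DerivedCategory.Plus.homologyFunctor _ i).obj E)) :
    ∃ (K : CochainComplex X.left.Modules ℤ) (_ : IsBoundedVBComplex K) (m : ℤ) (hm : K.IsStrictlyGE m),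
      Nonempty (DerivedCategory.Plus.Q.obj ⟨K, m, hm⟩ ≅ E) :=
  IsProjectiveOver.exists_isBoundedVBComplex_of_boundedCoh_of_isRegular hX.isProjectiveOver
    (IsSmoothProjective.isRegular hX) (IsSmoothProjective.ringKrullDim_stalk_le hX) E a b hE hb hcoh

/-- **Hartshorne III Ex. 6.9 (a) on a smooth projective variety over a field**: every coherent sheaf has a finite
resolution by locally free sheaves of finite rank (a `StrictlyPerfectResolution`), unconditionally — §2 on the
projective `X`, regular of dimension `≤ n`. [cite: Hartshorne1977, III Ex. 6.9 (a) (p. 238)] [cite: Fulton1998, App. B.8.3] -/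
theorem IsSmoothProjective.nonempty_strictlyPerfectResolution_of_coh (hX : IsSmoothProjective n X)
    {F : X.left.Modules} (hF : Coh F) : Nonempty (StrictlyPerfectResolution F) :=
  IsProjectiveOver.nonempty_strictlyPerfectResolution_of_coh_of_isRegular hX.isProjectiveOver
    (IsSmoothProjective.isRegular hX) (IsSmoothProjective.ringKrullDim_stalk_le hX) hF

end SmoothProjective

end Literature.AlgebraicGeometry.Modules

end
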